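import Literature.NumberTheory.DiophantineGeometry.ShuteFourSquarefulWeights

/-!
# Shute (2021), §5: the leading constant — its terms, absolute convergence, and the tails left out by `N(D, B)`

Sixth companion to `ShuteFourSquareful.lean` by this route (named fact
`Literature.NumberTheory.DiophantineGeometry.Shute2021_theorem11` = Theorem 1.1 of A. Shute,
*Sums of four squareful numbers*, arXiv:2104.06966), after `ShuteFourSquarefulMainCount.lean`
(`N(D, B) = Σ_d μ(d) Σ_𝐲 N⁺_{𝐬(d,𝐲)²𝐲³}(B)`), `ShuteFourSquarefulQuadCount.lean` (`N_𝐚(B)`, `Δ(𝐚)`,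
Lemma 4.13, the `s₀`-rescaling) and `ShuteFourSquarefulWeights.lean` (the weights
`w_θ(𝐲) = Δ(𝐲)^{3/4}|Y|^{θ−3/2}` of Lemma 5.3 are summable with tail `≪ D^{-1/4+θ}`). Everything here is
PROVED; the circle-method input is not assumed in this file except through the *shape* of the
main-term coefficient.

Theorem 4.2 gives `N_𝐚(B) = 𝔖_𝐚 σ_∞(𝛆) B / |A|^{1/2} + O_ε(B^{41/42+ε} Δ^{1/3} / |A|^{11/24})` and
Lemma 4.15 gives `𝔖_𝐚 ≪ |A|^ε Δ^{1/4}` (`A ≠ □`). Writing `𝔠(𝐚)` for an abstract main-term coefficient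
(in the paper `𝔠(𝐚) = 𝔖_𝐚 σ_∞(𝛆)`), this file sets up the summation of these main terms over the
index pairs `(d, 𝐲)` of `Shute2021.mainCountTrunc_eq_sum_moebius_posQuadCount`:

* `Shute2021.dShared`, `Shute2021.dFree` (`d = d₀d₁`, `d₁ = gcd(d, |y₁y₂y₃y₄|)`, `d₀` = the paper's
  `s₀`), `Shute2021.coeffVec` (`𝐚′(d, 𝐲)` with `𝐬(d,𝐲)²𝐲³ = d₀²𝐚′`, `Shute2021.sVec_sq_mul_cube_eq`),
  `|A′| = S′²|Y|³`, `A′ ≠ □ ⟺ Y ≠ □`, `|A′| ≤ |Y|¹¹`, `Δ(𝐚′)^{1/4} ≤ S′Δ(𝐲)^{3/4}` (Lemma 4.13),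
  `|A′|^{1/2} = S′|Y|^{3/2}`;
* `Shute2021.CoeffBound 𝔠` — the shape of Lemma 4.15: `|𝔠(𝐚)| ≤ C_ε |A|^ε Δ(𝐚)^{1/4}` for
  `𝐚 ∈ (ℤ_{≠0})⁴`, `A ≠ □`; `Shute2021.CircleMethodInput 𝔠` — the shape of Theorem 4.2 for
  `Shute2021.quadCount` (= the paper's `N_𝐚(B)`), `|A| ≤ B^{4/7}`;
* `Shute2021.cTerm 𝔠 (d, 𝐲) = μ(d) 𝔠(𝐚′) / (d₀² |A′|^{1/2})` on admissible pairs (`Shute2021.Adm`: `d`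
  square-free, `yᵢ ≠ 0` square-free, `Y ≠ □`) and **the constant**
  `Shute2021.cConst 𝔠 = (1/16) Σ_{(d,𝐲)} cTerm` — eq. (5.10) with the inclusion–exclusion weights
  `ω(𝐫, 𝐬, s₀)` of Definition 5.1 replaced by the Möbius weights of
  `mainCountTrunc_eq_sum_moebius_posQuadCount` (Lemma 5.2 as printed is false, see the erratum in
  `ShuteFourSquarefulMainCount.lean`);
* `Shute2021.abs_cTerm_le`: under `CoeffBound` at exponent `ε`, `|cTerm(d, 𝐲)| ≤ C w_{11ε}(𝐲)/d₀²`;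
  `Shute2021.sum_dFree_le` (reparametrization `d ↦ (d₀, d₁)`: `Σ_d g(d₀) ≤ τ(|Y|) Σ_n g(n)`),
  `Shute2021.exists_card_le_rpow` (`#{𝐲 ∈ (ℤ_{≠0})⁴ : |Y| ≤ D} ≪ D^{1+δ}`), the summation engine
  `Shute2021.sum_abs_cTerm_le`;
* `Shute2021.summable_cTerm`: the series of the constant converges absolutely (given `CoeffBound`);
* `Shute2021.const_tail_le` — **Lemma 5.3 together with the `s₀`-tail**: the part of the constant
  over pairs with `|Y| > D` or `d₀ > S₀` is `≪ D^{-η} + S₀^{κ−1}` (`η < 1/4`).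

## References

* A. Shute, *Sums of four squareful numbers*, arXiv:2104.06966v1 [math.NT] (2021), Theorem 4.2,
  Lemma 4.13, Lemma 4.15; §5: Definition 5.1, (5.7) (where `𝔖_{𝐬²𝐲³}σ_∞(𝛆)B/(S|Y|^{3/2}s₀²)`
  appears), Lemma 5.3 and its proof ((5.8)), (5.10). [Shute2021]
-/

noncomputable section

open Finset

namespace Literature.NumberTheory.DiophantineGeometry

namespace Shute2021

/-! ### The Möbius variable split at a fixed `𝐲`: `d = d₀ d₁` -/

/-- `d₁(d, 𝐲) = gcd(d, |y₁y₂y₃y₄|)`: the part of the (square-free) Möbius variable `d` built from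
primes dividing some `yᵢ` (Shute's `R S`-part). [cite: Shute2021, §5, Definition 5.1] -/
def dShared (d : ℕ) (y : Fin 4 → ℤ) : ℕ := Nat.gcd d (∏ j, y j).natAbs

/-- `d₀(d, 𝐲) = d / d₁(d, 𝐲)`: the part of `d` coprime to `y₁y₂y₃y₄` (Shute's `s₀`).
[cite: Shute2021, §5, Definition 5.1] -/
def dFree (d : ℕ) (y : Fin 4 → ℤ) : ℕ := d / dShared d y

/-- The coefficient vector after removing `s₀`: `𝐚′(d, 𝐲) = (sᵢ(d₁, 𝐲)² yᵢ³)ᵢ`, so that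
`𝐬(d, 𝐲)²𝐲³ = d₀² 𝐚′(d, 𝐲)` (Shute's `𝐬²𝐲³`). [cite: Shute2021, §5, (5.7)] -/
def coeffVec (d : ℕ) (y : Fin 4 → ℤ) : Fin 4 → ℤ :=
  fun i => (sVec (dShared d y) y i : ℤ) ^ 2 * y i ^ 3

/-- `S′(d, 𝐲) = ∏ᵢ sᵢ(d₁, 𝐲)`. [cite: Shute2021, §5 (notation `S = s₁s₂s₃s₄`)] -/
def sProd (d : ℕ) (y : Fin 4 → ℤ) : ℕ := ∏ i, sVec (dShared d y) y i

/-- `d = d₀ d₁`. [folklore] -/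
theorem dFree_mul_dShared (d : ℕ) (y : Fin 4 → ℤ) : dFree d y * dShared d y = d :=
  Nat.div_mul_cancel (Nat.gcd_dvd_left _ _)

/-- `d₁ ∣ |y₁y₂y₃y₄|`. [folklore] -/
theorem dShared_dvd (d : ℕ) (y : Fin 4 → ℤ) : dShared d y ∣ (∏ j, y j).natAbs :=
  Nat.gcd_dvd_right _ _

/-- For square-free `d` (hence `d ≥ 1`): `d₀, d₁ ≥ 1`. [folklore] -/
theorem dFree_pos_and {d : ℕ} (hd : Squarefree d) (y : Fin 4 → ℤ) :
    0 < dFree d y ∧ 0 < dShared d y := by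
  have h := dFree_mul_dShared d y
  constructor
  · refine Nat.pos_of_ne_zero fun h0 => hd.ne_zero ?_
    rw [← h, h0, zero_mul]
  · refine Nat.pos_of_ne_zero fun h0 => hd.ne_zero ?_
    rw [← h, h0, mul_zero]

/-- `d₀(d, 𝐲)` is coprime to every `yᵢ` (for square-free `d`). [folklore] -/
theorem coprime_dFree {d : ℕ} (hd : Squarefree d) (y : Fin 4 → ℤ) (i : Fin 4) :
    Nat.Coprime (dFree d y) (y i).natAbs :=
  coprime_div_gcd_prod hd y i

/-- The split `d ↦ (d₀, d₁)` is injective on square-free `d` (indeed `d = d₀d₁`). [folklore] -/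
theorem dFree_dShared_injective (y : Fin 4 → ℤ) {d d' : ℕ}
    (h : dFree d y = dFree d' y ∧ dShared d y = dShared d' y) : d = d' := by
  rw [← dFree_mul_dShared d y, ← dFree_mul_dShared d' y, h.1, h.2]

/-- `sᵢ(d₁, 𝐲) ≥ 1` for square-free `d`. [folklore] -/
theorem sVec_dShared_pos {d : ℕ} (hd : Squarefree d) (y : Fin 4 → ℤ) (i : Fin 4) :
    0 < sVec (dShared d y) y i :=
  sVec_pos (dFree_pos_and hd y).2 y i

/-- `sᵢ(d₁, 𝐲) ≤ d₁ ≤ |y₁y₂y₃y₄|` for `𝐲 ∈ (ℤ_{≠0})⁴`. [folklore] -/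
theorem sVec_dShared_le {d : ℕ} (y : Fin 4 → ℤ) (hy : ∀ i, y i ≠ 0) (i : Fin 4) :
    sVec (dShared d y) y i ≤ (∏ j, y j).natAbs := by
  have hY : 0 < (∏ j, y j).natAbs := Int.natAbs_pos.2 (prod_ne_zero_iff.2 fun j _ => hy j)
  exact (Nat.div_le_self _ _).trans (Nat.le_of_dvd hY (dShared_dvd d y))

/-- `𝐚′(d, 𝐲) ∈ (ℤ_{≠0})⁴` for square-free `d` and `𝐲 ∈ (ℤ_{≠0})⁴`. [folklore] -/
theorem coeffVec_ne_zero {d : ℕ} (hd : Squarefree d) {y : Fin 4 → ℤ} (hy : ∀ i, y i ≠ 0)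
    (i : Fin 4) : coeffVec d y i ≠ 0 :=
  mul_ne_zero (pow_ne_zero _ (by exact_mod_cast (sVec_dShared_pos hd y i).ne'))
    (pow_ne_zero _ (hy i))

/-- `|A′| = |∏ᵢ a′ᵢ| = S′² |y₁y₂y₃y₄|³`. [cite: Shute2021, §5 ("|S²Y³|")] -/
theorem abs_prod_coeffVec (d : ℕ) (y : Fin 4 → ℤ) :
    |∏ i, coeffVec d y i| = ((sProd d y : ℕ) : ℤ) ^ 2 * |∏ i, y i| ^ 3 := by
  unfold coeffVec sProd
  rw [prod_mul_distrib, abs_mul, prod_pow, prod_pow, abs_pow, abs_pow, Nat.cast_prod,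
    abs_of_nonneg (prod_nonneg fun i _ => by positivity)]

/-- `A′ ≠ □` iff `y₁y₂y₃y₄ ≠ □` ("assuming `Y ≠ □` we have `S²Y³ ≠ □`").
[cite: Shute2021, §5 (after (5.6))] -/
theorem isSquare_prod_coeffVec_iff {d : ℕ} (hd : Squarefree d) {y : Fin 4 → ℤ}
    (hy : ∀ i, y i ≠ 0) : IsSquare (∏ i, coeffVec d y i) ↔ IsSquare (∏ i, y i) := by
  have hS : ((sProd d y : ℕ) : ℤ) ≠ 0 := by
    unfold sProd
    exact_mod_cast (prod_pos fun i _ => sVec_dShared_pos hd y i).ne'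
  have hY : (∏ i, y i) ≠ 0 := prod_ne_zero_iff.2 fun i _ => hy i
  have key : ∏ i, coeffVec d y i = (∏ i, y i) * (((sProd d y : ℕ) : ℤ) * ∏ i, y i) ^ 2 := by
    unfold coeffVec sProd
    rw [prod_mul_distrib, prod_pow, prod_pow, Nat.cast_prod]; ring
  rw [key]
  exact isSquare_mul_sq_iff (mul_ne_zero hS hY)

/-- `|A′| ≤ |y₁y₂y₃y₄|¹¹` (`S′ ≤ |Y|⁴`); in the paper `|S²Y³| ≤ D⁹` from `S ∣ Y³`.
[cite: Shute2021, §5 ("Therefore |Y| ≤ D implies that |S²Y³| ≤ D⁹")] -/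
theorem abs_prod_coeffVec_le {d : ℕ} {y : Fin 4 → ℤ} (hy : ∀ i, y i ≠ 0) :
    |∏ i, coeffVec d y i| ≤ |∏ i, y i| ^ 11 := by
  rw [abs_prod_coeffVec]
  have hSn : sProd d y ≤ (∏ i, y i).natAbs ^ 4 := by
    unfold sProd
    calc ∏ i, sVec (dShared d y) y i ≤ ∏ _i : Fin 4, (∏ j, y j).natAbs :=
          prod_le_prod' fun i _ => sVec_dShared_le y hy i
      _ = (∏ i, y i).natAbs ^ 4 := by rw [prod_const, card_univ, Fintype.card_fin]
  have hS : ((sProd d y : ℕ) : ℤ) ≤ |∏ i, y i| ^ 4 := by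
    have h := (Nat.cast_le (α := ℤ)).2 hSn
    rwa [Nat.cast_pow, Int.natCast_natAbs] at h
  have hS0 : (0 : ℤ) ≤ ((sProd d y : ℕ) : ℤ) := by positivity
  calc ((sProd d y : ℕ) : ℤ) ^ 2 * |∏ i, y i| ^ 3 ≤ (|∏ i, y i| ^ 4) ^ 2 * |∏ i, y i| ^ 3 := by
        gcongr
    _ = |∏ i, y i| ^ 11 := by ring

/-- The original coefficient vector is `d₀²` times `𝐚′`: `𝐬(d, 𝐲)²𝐲³ = d₀² 𝐚′(d, 𝐲)`.
[cite: Shute2021, §5 (display after (5.6))] -/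
theorem sVec_sq_mul_cube_eq {d : ℕ} (hd : Squarefree d) (y : Fin 4 → ℤ) (i : Fin 4) :
    (sVec d y i : ℤ) ^ 2 * y i ^ 3 = (dFree d y : ℤ) ^ 2 * coeffVec d y i := by
  unfold coeffVec
  rw [show sVec d y i = dFree d y * sVec (dShared d y) y i by
    rw [← sVec_mul_left (coprime_dFree hd y), dFree_mul_dShared]]
  push_cast; ring

/-- `Δ(𝐚′)^{1/4} ≤ S′ Δ(𝐲)^{3/4}` (Lemma 4.13). [cite: Shute2021, §5, proof of Lemma 5.3] -/
theorem delta_coeffVec_rpow_le {d : ℕ} (hd : Squarefree d) {y : Fin 4 → ℤ} (hy : ∀ i, y i ≠ 0) :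
    (delta (coeffVec d y) : ℝ) ^ (1 / 4 : ℝ) ≤ (sProd d y : ℝ) * (delta y : ℝ) ^ (3 / 4 : ℝ) := by
  have h := delta_sq_mul_cube_le (sVec_dShared_pos hd y) hy
  have h' : (delta (coeffVec d y) : ℝ) ≤ ((sProd d y : ℕ) : ℝ) ^ 4 * (delta y : ℝ) ^ 3 := by
    unfold coeffVec sProd; exact_mod_cast h
  have hS : (0 : ℝ) ≤ (sProd d y : ℝ) := Nat.cast_nonneg _
  have hD : (0 : ℝ) ≤ (delta y : ℝ) := Nat.cast_nonneg _
  calc (delta (coeffVec d y) : ℝ) ^ (1 / 4 : ℝ)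
      ≤ (((sProd d y : ℕ) : ℝ) ^ 4 * (delta y : ℝ) ^ 3) ^ (1 / 4 : ℝ) :=
        Real.rpow_le_rpow (Nat.cast_nonneg _) h' (by norm_num)
    _ = (sProd d y : ℝ) * (delta y : ℝ) ^ (3 / 4 : ℝ) := by
        rw [Real.mul_rpow (by positivity) (by positivity),
          show ((sProd d y : ℕ) : ℝ) ^ 4 = ((sProd d y : ℕ) : ℝ) ^ ((4 : ℕ) : ℝ) from
            (Real.rpow_natCast _ 4).symm,
          show (delta y : ℝ) ^ 3 = (delta y : ℝ) ^ ((3 : ℕ) : ℝ) from (Real.rpow_natCast _ 3).symm,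
          ← Real.rpow_mul hS, ← Real.rpow_mul hD]
        norm_num

/-- `|A′|^{1/2} = S′ |y₁y₂y₃y₄|^{3/2}`. [cite: Shute2021, §5, (5.7) ("S|Y|^{3/2}")] -/
theorem abs_prod_coeffVec_rpow_half (d : ℕ) {y : Fin 4 → ℤ} (hy : ∀ i, y i ≠ 0) :
    ((|∏ i, coeffVec d y i| : ℤ) : ℝ) ^ (1 / 2 : ℝ) =
      (sProd d y : ℝ) * ((|∏ i, y i| : ℤ) : ℝ) ^ (3 / 2 : ℝ) := by
  have hY : (0 : ℝ) < ((|∏ i, y i| : ℤ) : ℝ) := by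
    have : (∏ i, y i) ≠ 0 := prod_ne_zero_iff.2 fun i _ => hy i
    exact_mod_cast abs_pos.2 this
  have hS : (0 : ℝ) ≤ (sProd d y : ℝ) := Nat.cast_nonneg _
  rw [abs_prod_coeffVec, Int.cast_mul, Int.cast_pow, Int.cast_pow, Int.cast_natCast,
    Real.mul_rpow (by positivity) (by positivity),
    show ((sProd d y : ℕ) : ℝ) ^ 2 = ((sProd d y : ℕ) : ℝ) ^ ((2 : ℕ) : ℝ) from
      (Real.rpow_natCast _ 2).symm,
    show ((|∏ i, y i| : ℤ) : ℝ) ^ 3 = ((|∏ i, y i| : ℤ) : ℝ) ^ ((3 : ℕ) : ℝ) from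
      (Real.rpow_natCast _ 3).symm,
    ← Real.rpow_mul hS, ← Real.rpow_mul hY.le]
  norm_num

/-! ### The terms of the constant and their size -/

/-- Admissible index pairs `(d, 𝐲)`: `d` square-free, `𝐲 ∈ (ℤ_{≠0})⁴` with square-free coordinates
and `y₁y₂y₃y₄ ≠ □`. [cite: Shute2021, §5, (5.10)] -/
def Adm (p : ℕ × (Fin 4 → ℤ)) : Prop :=
  Squarefree p.1 ∧ (∀ i, p.2 i ≠ 0 ∧ Squarefree (p.2 i).natAbs) ∧ ¬ IsSquare (∏ i, p.2 i)

open Classical in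
/-- The `(d, 𝐲)`-term of the leading constant: `μ(d) 𝔠(𝐚′) / (d₀² |A′|^{1/2})`, where `𝔠(𝐚)`
abstracts `𝔖_𝐚 σ_∞(𝛆)` (so that the main term of Theorem 4.2 for `N_𝐚(B)` is `𝔠(𝐚) B / |A|^{1/2}`);
zero off the admissible pairs. [cite: Shute2021, §5, (5.7) and (5.10)] -/
def cTerm (𝔠 : (Fin 4 → ℤ) → ℝ) (p : ℕ × (Fin 4 → ℤ)) : ℝ :=
  if Adm p then
    (ArithmeticFunction.moebius p.1 : ℝ) * 𝔠 (coeffVec p.1 p.2) /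
      ((dFree p.1 p.2 : ℝ) ^ 2 * ((|∏ i, coeffVec p.1 p.2 i| : ℤ) : ℝ) ^ (1 / 2 : ℝ))
  else 0

/-- **The leading constant** of the corrected §5 (eq. (5.10) with the inclusion–exclusion weights
`ω(𝐫, 𝐬, s₀)` replaced by the Möbius weights of `mainCountTrunc_eq_sum_moebius_posQuadCount`):
`c = (1/16) Σ_{(d,𝐲) admissible} μ(d) 𝔠(𝐚′(d,𝐲)) / (d₀(d,𝐲)² |A′(d,𝐲)|^{1/2})`, an absolutely
convergent series when `|𝔠(𝐚)| ≪ |A|^ε Δ(𝐚)^{1/4}` (Lemma 4.15). [cite: Shute2021, §5, (5.10)] -/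
def cConst (𝔠 : (Fin 4 → ℤ) → ℝ) : ℝ := (1 / 16) * ∑' p : ℕ × (Fin 4 → ℤ), cTerm 𝔠 p

/-- The shape of Lemma 4.15 for the abstract main-term coefficient: `|𝔠(𝐚)| ≤ C_ε |A|^ε Δ(𝐚)^{1/4}`
for `𝐚 ∈ (ℤ_{≠0})⁴` with `A ≠ □`. (For `𝔠(𝐚) = 𝔖_𝐚 σ_∞(𝛆)` this is Lemma 4.15 together with
`σ_∞(𝛆) ≪ 1`.) [cite: Shute2021, Lemma 4.15] -/
def CoeffBound (𝔠 : (Fin 4 → ℤ) → ℝ) : Prop :=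
  ∀ ε : ℝ, 0 < ε → ∃ C : ℝ, ∀ a : Fin 4 → ℤ, (∀ i, a i ≠ 0) → ¬ IsSquare (∏ i, a i) →
    |𝔠 a| ≤ C * ((|∏ i, a i| : ℤ) : ℝ) ^ ε * (delta a : ℝ) ^ (1 / 4 : ℝ)

/-- The shape of Theorem 4.2 (= Thm. 1.3) with the abstract coefficient `𝔠(𝐚)` in place of
`𝔖_𝐚 σ_∞(𝛆)`: for `𝐚 ∈ (ℤ_{≠0})⁴` with `A ≠ □` and `|A| ≤ B^{4/7}`,
`N_𝐚(B) = 𝔠(𝐚) B / |A|^{1/2} + O_ε(B^{41/42+ε} Δ^{1/3} / |A|^{11/24})`.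
[cite: Shute2021, Theorem 4.2] -/
def CircleMethodInput (𝔠 : (Fin 4 → ℤ) → ℝ) : Prop :=
  ∀ ε : ℝ, 0 < ε → ∃ C : ℝ, ∀ (a : Fin 4 → ℤ) (B : ℕ), 1 ≤ B → (∀ i, a i ≠ 0) →
    ¬ IsSquare (∏ i, a i) → ((|∏ i, a i| : ℤ) : ℝ) ≤ (B : ℝ) ^ (4 / 7 : ℝ) →
      |(quadCount a B : ℝ) - 𝔠 a * B / ((|∏ i, a i| : ℤ) : ℝ) ^ (1 / 2 : ℝ)| ≤
        C * (B : ℝ) ^ (41 / 42 + ε : ℝ) * (delta a : ℝ) ^ (1 / 3 : ℝ) /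
          ((|∏ i, a i| : ℤ) : ℝ) ^ (11 / 24 : ℝ)

/-- **Size of the terms.** Under `CoeffBound 𝔠` with exponent `ε`: for admissible `(d, 𝐲)`,
`|cTerm(d, 𝐲)| ≤ C_ε w_{11ε}(𝐲) / d₀(d, 𝐲)²` (`|𝔠(𝐚′)| ≤ C|A′|^εΔ(𝐚′)^{1/4}`,
`Δ(𝐚′)^{1/4} ≤ S′Δ(𝐲)^{3/4}`, `|A′|^{1/2} = S′|Y|^{3/2}`, `|A′| ≤ |Y|¹¹`).
[cite: Shute2021, §5, proof of Lemma 5.3 ((5.8) and the display after it)] -/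
theorem abs_cTerm_le {𝔠 : (Fin 4 → ℤ) → ℝ} {ε C : ℝ} (hε : 0 < ε)
    (hC : ∀ a : Fin 4 → ℤ, (∀ i, a i ≠ 0) → ¬ IsSquare (∏ i, a i) →
      |𝔠 a| ≤ C * ((|∏ i, a i| : ℤ) : ℝ) ^ ε * (delta a : ℝ) ^ (1 / 4 : ℝ))
    {d : ℕ} {y : Fin 4 → ℤ} (hp : Adm (d, y)) :
    |cTerm 𝔠 (d, y)| ≤ max C 0 * weight (11 * ε) y / (dFree d y : ℝ) ^ 2 := by
  obtain ⟨hd, hy, hsq⟩ := hp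
  have hy0 : ∀ i, y i ≠ 0 := fun i => (hy i).1
  have hd0 : (0 : ℝ) < dFree d y := by exact_mod_cast (dFree_pos_and hd y).1
  have hS : (0 : ℝ) < sProd d y := by
    unfold sProd; exact_mod_cast prod_pos fun i _ => sVec_dShared_pos hd y i
  have hYpos : (0 : ℝ) < ((|∏ i, y i| : ℤ) : ℝ) := by
    have : (∏ i, y i) ≠ 0 := prod_ne_zero_iff.2 fun i _ => hy0 i
    exact_mod_cast abs_pos.2 this
  have hA' : ∀ i, coeffVec d y i ≠ 0 := coeffVec_ne_zero hd hy0
  have hA'sq : ¬ IsSquare (∏ i, coeffVec d y i) := by rwa [isSquare_prod_coeffVec_iff hd hy0]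
  have hApos : (0 : ℝ) < ((|∏ i, coeffVec d y i| : ℤ) : ℝ) := by
    have : (∏ i, coeffVec d y i) ≠ 0 := prod_ne_zero_iff.2 fun i _ => hA' i
    exact_mod_cast abs_pos.2 this
  -- the bound on `𝔠(𝐚′)`
  have h1 := hC _ hA' hA'sq
  have hC' : C * ((|∏ i, coeffVec d y i| : ℤ) : ℝ) ^ ε * (delta (coeffVec d y) : ℝ) ^ (1 / 4 : ℝ)
      ≤ max C 0 * ((|∏ i, coeffVec d y i| : ℤ) : ℝ) ^ ε *
        ((sProd d y : ℝ) * (delta y : ℝ) ^ (3 / 4 : ℝ)) := by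
    calc C * ((|∏ i, coeffVec d y i| : ℤ) : ℝ) ^ ε * (delta (coeffVec d y) : ℝ) ^ (1 / 4 : ℝ)
        ≤ max C 0 * ((|∏ i, coeffVec d y i| : ℤ) : ℝ) ^ ε *
            (delta (coeffVec d y) : ℝ) ^ (1 / 4 : ℝ) := by
          gcongr; exact le_max_left _ _
      _ ≤ _ := mul_le_mul_of_nonneg_left (delta_coeffVec_rpow_le hd hy0) (by positivity)
  -- `|A′|^ε ≤ |Y|^{11ε}`
  have h2 : ((|∏ i, coeffVec d y i| : ℤ) : ℝ) ^ ε ≤ ((|∏ i, y i| : ℤ) : ℝ) ^ (11 * ε) := by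
    rw [Real.rpow_mul hYpos.le]
    refine Real.rpow_le_rpow (by positivity) ?_ hε.le
    rw [show (11 : ℝ) = ((11 : ℕ) : ℝ) by norm_num, Real.rpow_natCast]
    exact_mod_cast abs_prod_coeffVec_le (d := d) hy0
  -- unfold the term
  have hterm : cTerm 𝔠 (d, y) = (ArithmeticFunction.moebius d : ℝ) * 𝔠 (coeffVec d y) /
      ((dFree d y : ℝ) ^ 2 * ((|∏ i, coeffVec d y i| : ℤ) : ℝ) ^ (1 / 2 : ℝ)) := by
    unfold cTerm; rw [if_pos ⟨hd, hy, hsq⟩]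
  have hmu : |(ArithmeticFunction.moebius d : ℝ)| ≤ 1 := by
    have := ArithmeticFunction.abs_moebius_le_one (n := d)
    exact_mod_cast this
  -- `|μ(d)| |𝔠(𝐚′)| ≤ maxC · |Y|^{11ε} · S′ Δ(𝐲)^{3/4}`
  have hnum : |(ArithmeticFunction.moebius d : ℝ)| * |𝔠 (coeffVec d y)| ≤
      max C 0 * ((|∏ i, y i| : ℤ) : ℝ) ^ (11 * ε) *
        ((sProd d y : ℝ) * (delta y : ℝ) ^ (3 / 4 : ℝ)) := by
    calc |(ArithmeticFunction.moebius d : ℝ)| * |𝔠 (coeffVec d y)|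
        ≤ 1 * |𝔠 (coeffVec d y)| := mul_le_mul_of_nonneg_right hmu (abs_nonneg _)
      _ = |𝔠 (coeffVec d y)| := one_mul _
      _ ≤ max C 0 * ((|∏ i, coeffVec d y i| : ℤ) : ℝ) ^ ε *
            ((sProd d y : ℝ) * (delta y : ℝ) ^ (3 / 4 : ℝ)) := h1.trans hC'
      _ ≤ max C 0 * ((|∏ i, y i| : ℤ) : ℝ) ^ (11 * ε) *
            ((sProd d y : ℝ) * (delta y : ℝ) ^ (3 / 4 : ℝ)) := by
          refine mul_le_mul_of_nonneg_right ?_ (by positivity)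
          exact mul_le_mul_of_nonneg_left h2 (le_max_right _ _)
  -- the weight through `|Y|^{11ε}` and `|Y|^{3/2}`
  have hw : weight (11 * ε) y = (delta y : ℝ) ^ (3 / 4 : ℝ) *
      (((|∏ i, y i| : ℤ) : ℝ) ^ (11 * ε) / ((|∏ i, y i| : ℤ) : ℝ) ^ (3 / 2 : ℝ)) := by
    unfold weight
    rw [Nat.cast_natAbs, Int.cast_abs, ← Real.rpow_sub (by rwa [Int.cast_abs] at hYpos)]
  have hden : (0 : ℝ) < (dFree d y : ℝ) ^ 2 * ((sProd d y : ℝ) *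
      ((|∏ i, y i| : ℤ) : ℝ) ^ (3 / 2 : ℝ)) := by positivity
  rw [hterm, abs_div, abs_mul, abs_prod_coeffVec_rpow_half d hy0, abs_of_pos hden]
  calc |(ArithmeticFunction.moebius d : ℝ)| * |𝔠 (coeffVec d y)| /
        ((dFree d y : ℝ) ^ 2 * ((sProd d y : ℝ) * ((|∏ i, y i| : ℤ) : ℝ) ^ (3 / 2 : ℝ)))
      ≤ max C 0 * ((|∏ i, y i| : ℤ) : ℝ) ^ (11 * ε) *
          ((sProd d y : ℝ) * (delta y : ℝ) ^ (3 / 4 : ℝ)) /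
        ((dFree d y : ℝ) ^ 2 * ((sProd d y : ℝ) * ((|∏ i, y i| : ℤ) : ℝ) ^ (3 / 2 : ℝ))) :=
        div_le_div_of_nonneg_right hnum hden.le
    _ = max C 0 * weight (11 * ε) y / (dFree d y : ℝ) ^ 2 := by
        rw [hw]
        field_simp

/-! ### Summation over the Möbius variable at fixed `𝐲` -/

/-- **Reparametrizing `d ↦ (d₀, d₁)`**: for `𝐲 ∈ (ℤ_{≠0})⁴`, a finite set `F ⊂ ℕ` and `g ≥ 0`,
`Σ_{d ∈ F} g(d₀(d, 𝐲)) ≤ τ(|y₁y₂y₃y₄|) · Σ_{n ∈ d₀(F)} g(n)` (`d = d₀d₁` with `d₁ ∣ |Y|`).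
[cite: Shute2021, §5, proof of Lemma 5.3 ("the sum over 𝐫 only contributes O(Y^ε)")] -/
theorem sum_dFree_le {y : Fin 4 → ℤ} (hy : ∀ i, y i ≠ 0) (F : Finset ℕ) (g : ℕ → ℝ)
    (hg : ∀ n, 0 ≤ g n) :
    ∑ d ∈ F, g (dFree d y) ≤
      #((∏ i, y i).natAbs.divisors) * ∑ n ∈ F.image (fun d => dFree d y), g n := by
  classical
  have hY : (∏ i, y i).natAbs ≠ 0 := Int.natAbs_ne_zero.2 (prod_ne_zero_iff.2 fun i _ => hy i)
  set φ : ℕ → ℕ × ℕ := fun d => (dFree d y, dShared d y) with hφ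
  have hinj : Set.InjOn φ F := fun d _ d' _ h => by
    simp only [hφ, Prod.mk.injEq] at h
    exact dFree_dShared_injective y h
  have hsub : F.image φ ⊆ (F.image fun d => dFree d y) ×ˢ (∏ i, y i).natAbs.divisors := by
    intro q hq
    rw [mem_image] at hq
    obtain ⟨d, hd, rfl⟩ := hq
    rw [mem_product, Nat.mem_divisors]
    exact ⟨mem_image_of_mem _ hd, dShared_dvd d y, hY⟩
  have hstep : ∑ d ∈ F, g (dFree d y) = ∑ q ∈ F.image φ, g q.1 := by
    rw [sum_image hinj]
  calc ∑ d ∈ F, g (dFree d y) = ∑ q ∈ F.image φ, g q.1 := hstep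
    _ ≤ ∑ q ∈ (F.image fun d => dFree d y) ×ˢ (∏ i, y i).natAbs.divisors, g q.1 :=
        sum_le_sum_of_subset_of_nonneg hsub fun q _ _ => hg q.1
    _ = #((∏ i, y i).natAbs.divisors) * ∑ n ∈ F.image (fun d => dFree d y), g n := by
        rw [sum_product, mul_sum]
        refine sum_congr rfl fun n _ => ?_
        dsimp only
        rw [sum_const, nsmul_eq_mul]

/-! ### Counting the admissible `𝐲` with `|y₁y₂y₃y₄| ≤ D` -/

/-- For `m ≥ 1`, at most `16 τ(m)³` vectors `𝐲 ∈ ℤ⁴` have `|y₁y₂y₃y₄| = m` (signs, and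
`|y₁|, |y₂|, |y₃| ∣ m` determine `𝐲`). [folklore] -/
theorem card_filter_natAbs_prod_eq_le (s : Finset (Fin 4 → ℤ)) {m : ℕ} (hm : m ≠ 0) :
    #{y ∈ s | (∏ i, y i).natAbs = m} ≤ 16 * #m.divisors ^ 3 := by
  classical
  set Sg := Fintype.piFinset fun _ : Fin 4 => ({-1, 1} : Finset ℤ) with hSg
  have hT : #(Sg ×ˢ (m.divisors ×ˢ m.divisors ×ˢ m.divisors)) = 16 * #m.divisors ^ 3 := by
    rw [card_product, card_product, card_product, card_signs]; ring
  rw [← hT]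
  refine card_le_card_of_injOn
    (fun y => (fun i => (y i).sign, ((y 0).natAbs, (y 1).natAbs, (y 2).natAbs))) ?_ ?_
  · intro y hy
    rw [mem_coe, mem_filter] at hy
    obtain ⟨-, hym⟩ := hy
    have hy0 : ∀ i, y i ≠ 0 := fun i h0 => hm (by
      rw [← hym, Int.natAbs_eq_zero]; exact prod_eq_zero (mem_univ i) h0)
    have hdv : ∀ i, (y i).natAbs ∣ m := fun i => by
      rw [← hym, show (∏ j, y j).natAbs = ∏ j, (y j).natAbs from map_prod Int.natAbsHom y univ]
      exact dvd_prod_of_mem _ (mem_univ i)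
    simp only [mem_coe, mem_product, hSg, Fintype.mem_piFinset, Nat.mem_divisors]
    exact ⟨fun i => sign_mem_of_ne_zero (hy0 i), ⟨hdv 0, hm⟩, ⟨hdv 1, hm⟩, ⟨hdv 2, hm⟩⟩
  · intro y hy y' hy' h
    rw [mem_coe, mem_filter] at hy hy'
    simp only [Prod.mk.injEq] at h
    obtain ⟨hsgn, h0, h1, h2⟩ := h
    have habs : ∀ i, (y i).natAbs = (y' i).natAbs := by
      have hp : (∏ i, y i).natAbs = (∏ i, y' i).natAbs := hy.2.trans hy'.2.symm
      rw [show (∏ j, y j).natAbs = ∏ j, (y j).natAbs from map_prod Int.natAbsHom y univ,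
        show (∏ j, y' j).natAbs = ∏ j, (y' j).natAbs from map_prod Int.natAbsHom y' univ,
        Fin.prod_univ_four, Fin.prod_univ_four, h0, h1, h2] at hp
      have hpos : 0 < (y' 0).natAbs * (y' 1).natAbs * (y' 2).natAbs := by
        rcases Nat.eq_zero_or_pos ((y' 0).natAbs * (y' 1).natAbs * (y' 2).natAbs) with h | h
        · exfalso; apply hm; rw [← hy'.2,
            show (∏ j, y' j).natAbs = ∏ j, (y' j).natAbs from map_prod Int.natAbsHom y' univ,
            Fin.prod_univ_four, h, zero_mul]
        · exact h
      have h3 : (y 3).natAbs = (y' 3).natAbs := Nat.eq_of_mul_eq_mul_left hpos hp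
      intro i; fin_cases i <;> assumption
    funext i
    rw [← Int.sign_mul_natAbs (y i), ← Int.sign_mul_natAbs (y' i), congrFun hsgn i, habs i]

/-- **The number of `𝐲 ∈ (ℤ_{≠0})⁴` with `|y₁y₂y₃y₄| ≤ D` is `O_δ(D^{1+δ})`** (`Σ_{m ≤ D} 16τ(m)³`).
This is the size of the `𝐲`-range of `N(D, B)` (the sum in (5.7), (5.9)).
[cite: Shute2021, §5, proof of Lemma 5.4] -/
theorem exists_card_le_rpow {δ : ℝ} (hδ : 0 < δ) :
    ∃ C : ℝ, 0 < C ∧ ∀ (s : Finset (Fin 4 → ℤ)) (D : ℕ),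
      (∀ y ∈ s, (∀ i, y i ≠ 0) ∧ (∏ i, y i).natAbs ≤ D) → (#s : ℝ) ≤ C * (D : ℝ) ^ (1 + δ) := by
  classical
  have hδ3 : 0 < δ / 3 := by positivity
  obtain ⟨Cd, hCd1, hCd⟩ := Literature.NumberTheory.Sieve.exists_card_divisors_le_mul_rpow hδ3
  refine ⟨16 * Cd ^ 3, by positivity, fun s D hs => ?_⟩
  have hmaps : ∀ y ∈ s, (∏ i, y i).natAbs ∈ Icc 1 D := fun y hy => by
    rw [mem_Icc]
    exact ⟨Nat.one_le_iff_ne_zero.2 (Int.natAbs_ne_zero.2 (prod_ne_zero_iff.2 fun i _ => (hs y hy).1 i)),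
      (hs y hy).2⟩
  rw [card_eq_sum_card_fiberwise hmaps]
  push_cast
  calc ∑ m ∈ Icc 1 D, (#{y ∈ s | (∏ i, y i).natAbs = m} : ℝ)
      ≤ ∑ m ∈ Icc 1 D, 16 * Cd ^ 3 * (D : ℝ) ^ δ := by
        refine sum_le_sum fun m hm => ?_
        have hm0 : m ≠ 0 := by rw [mem_Icc] at hm; omega
        have hmD : (m : ℝ) ≤ D := by rw [mem_Icc] at hm; exact_mod_cast hm.2
        have h1 := card_filter_natAbs_prod_eq_le s hm0
        have h2 : ((#m.divisors : ℕ) : ℝ) ^ 3 ≤ (Cd * (m : ℝ) ^ (δ / 3)) ^ 3 :=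
          pow_le_pow_left₀ (Nat.cast_nonneg _) (hCd m hm0) 3
        have h3 : (Cd * (m : ℝ) ^ (δ / 3)) ^ 3 = Cd ^ 3 * (m : ℝ) ^ δ := by
          rw [mul_pow, show ((m : ℝ) ^ (δ / 3)) ^ 3 = ((m : ℝ) ^ (δ / 3)) ^ ((3 : ℕ) : ℝ) from
            (Real.rpow_natCast _ 3).symm, ← Real.rpow_mul (Nat.cast_nonneg m)]
          norm_num
        have h4 : (m : ℝ) ^ δ ≤ (D : ℝ) ^ δ := Real.rpow_le_rpow (Nat.cast_nonneg m) hmD hδ.le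
        calc (#{y ∈ s | (∏ i, y i).natAbs = m} : ℝ) ≤ ((16 * #m.divisors ^ 3 : ℕ) : ℝ) := by
              exact_mod_cast h1
          _ = 16 * ((#m.divisors : ℕ) : ℝ) ^ 3 := by push_cast; ring
          _ ≤ 16 * (Cd ^ 3 * (m : ℝ) ^ δ) := by rw [← h3]; gcongr
          _ ≤ 16 * Cd ^ 3 * (D : ℝ) ^ δ := by rw [mul_assoc]; gcongr
    _ = (D : ℝ) * (16 * Cd ^ 3 * (D : ℝ) ^ δ) := by
        rw [sum_const, Nat.card_Icc, nsmul_eq_mul]; push_cast; ring_nf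
    _ = 16 * Cd ^ 3 * (D : ℝ) ^ (1 + δ) := by
        rw [Real.rpow_add' (Nat.cast_nonneg D) (by linarith), Real.rpow_one]; ring

/-! ### Bounding sums of `|cTerm|` -/

/-- `1/n² = n^{-2}` for the real power. [folklore] -/
theorem one_div_sq_eq_rpow (n : ℕ) : 1 / ((n : ℝ) ^ 2) = (n : ℝ) ^ (-(2 : ℝ)) := by
  rw [Real.rpow_neg (Nat.cast_nonneg n), one_div,
    show ((n : ℝ) ^ (2 : ℝ)) = (n : ℝ) ^ ((2 : ℕ) : ℝ) by norm_num, Real.rpow_natCast]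

/-- **The summation engine.** Under `CoeffBound` (at exponent `ε` with constant `C`): for a finite
set `U` of admissible pairs whose `d₀`-values satisfy a property `P`, and a bound `Z` for
`Σ_{n ∈ T} n^{-2}` over finite sets `T` of naturals with `P`,
`Σ_{(d,𝐲) ∈ U} |cTerm(d, 𝐲)| ≤ max(C,0) · Z · Σ_{𝐲} τ(|Y|) w_{11ε}(𝐲)` (the `𝐲` running over the
second projection of `U`). [cite: Shute2021, §5, proof of Lemma 5.3] -/
theorem sum_abs_cTerm_le {𝔠 : (Fin 4 → ℤ) → ℝ} {ε C : ℝ} (hε : 0 < ε)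
    (hC : ∀ a : Fin 4 → ℤ, (∀ i, a i ≠ 0) → ¬ IsSquare (∏ i, a i) →
      |𝔠 a| ≤ C * ((|∏ i, a i| : ℤ) : ℝ) ^ ε * (delta a : ℝ) ^ (1 / 4 : ℝ))
    (P : ℕ → Prop) {Z : ℝ}
    (hZ : ∀ T : Finset ℕ, (∀ n ∈ T, P n) → ∑ n ∈ T, (n : ℝ) ^ (-(2 : ℝ)) ≤ Z)
    (U : Finset (ℕ × (Fin 4 → ℤ))) (hU : ∀ p ∈ U, Adm p ∧ P (dFree p.1 p.2)) :
    ∑ p ∈ U, |cTerm 𝔠 p| ≤ max C 0 * Z *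
      ∑ y ∈ U.image Prod.snd, #((∏ i, y i).natAbs.divisors) * weight (11 * ε) y := by
  classical
  -- termwise bound
  have h1 : ∑ p ∈ U, |cTerm 𝔠 p| ≤
      ∑ p ∈ U, max C 0 * weight (11 * ε) p.2 * (1 / (dFree p.1 p.2 : ℝ) ^ 2) := by
    refine sum_le_sum fun p hp => ?_
    have := abs_cTerm_le hε hC (d := p.1) (y := p.2) (hU p hp).1
    rw [mul_one_div]; exact this
  refine h1.trans ?_
  -- fibre over `𝐲`
  rw [← sum_fiberwise_of_maps_to (g := Prod.snd) (fun p hp => mem_image_of_mem Prod.snd hp), mul_sum]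
  refine sum_le_sum fun y hy => ?_
  have hyU : ∃ p ∈ U, p.2 = y := by simpa [mem_image] using hy
  obtain ⟨p₀, hp₀, rfl⟩ := hyU
  have hy0 : ∀ i, p₀.2 i ≠ 0 := fun i => ((hU p₀ hp₀).1.2.1 i).1
  -- inside the fibre the second coordinate is `y`; pass to the set of first coordinates
  set F : Finset ℕ := (U.filter fun p => p.2 = p₀.2).image Prod.fst with hF
  have hfib : ∑ p ∈ U with p.2 = p₀.2, max C 0 * weight (11 * ε) p.2 * (1 / (dFree p.1 p.2 : ℝ) ^ 2) =
      max C 0 * weight (11 * ε) p₀.2 * ∑ d ∈ F, (1 / (dFree d p₀.2 : ℝ) ^ 2) := by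
    rw [mul_sum, hF, sum_image]
    · refine sum_congr rfl fun p hp => ?_
      rw [(mem_filter.1 hp).2]
    · intro p hp p' hp' h
      exact Prod.ext h ((mem_filter.1 hp).2.trans (mem_filter.1 hp').2.symm)
  rw [hfib]
  -- the `d`-sum: `Σ_{d ∈ F} d₀(d)^{-2} ≤ τ(|Y|) Z`
  have hdsum : ∑ d ∈ F, (1 / (dFree d p₀.2 : ℝ) ^ 2) ≤ #((∏ i, p₀.2 i).natAbs.divisors) * Z := by
    refine (sum_dFree_le hy0 F (fun n => 1 / (n : ℝ) ^ 2) fun n => by positivity).trans ?_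
    refine mul_le_mul_of_nonneg_left ?_ (Nat.cast_nonneg _)
    simp only [one_div_sq_eq_rpow]
    refine hZ _ fun n hn => ?_
    rw [mem_image] at hn
    obtain ⟨d, hd, rfl⟩ := hn
    rw [hF, mem_image] at hd
    obtain ⟨p, hp, rfl⟩ := hd
    rw [mem_filter] at hp
    simpa [hp.2] using (hU p hp.1).2
  calc max C 0 * weight (11 * ε) p₀.2 * ∑ d ∈ F, (1 / (dFree d p₀.2 : ℝ) ^ 2)
      ≤ max C 0 * weight (11 * ε) p₀.2 * (#((∏ i, p₀.2 i).natAbs.divisors) * Z) :=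
        mul_le_mul_of_nonneg_left hdsum (mul_nonneg (le_max_right _ _) (weight_nonneg _ _))
    _ = max C 0 * Z * (#((∏ i, p₀.2 i).natAbs.divisors) * weight (11 * ε) p₀.2) := by ring

/-- `τ(|Y|) w_θ(𝐲) ≤ C_δ w_{θ+δ}(𝐲)` (divisor bound). [folklore] -/
theorem card_divisors_mul_weight_le {δ Cd : ℝ} (hCd : ∀ n : ℕ, n ≠ 0 → (#n.divisors : ℝ) ≤ Cd * (n : ℝ) ^ δ)
    (θ : ℝ) {y : Fin 4 → ℤ} (hy : ∀ i, y i ≠ 0) :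
    #((∏ i, y i).natAbs.divisors) * weight θ y ≤ Cd * weight (θ + δ) y := by
  have hY : (∏ i, y i).natAbs ≠ 0 := Int.natAbs_ne_zero.2 (prod_ne_zero_iff.2 fun i _ => hy i)
  rw [weight_add θ δ hy, mul_comm Cd, mul_assoc, mul_comm _ Cd]
  rw [mul_comm]
  exact mul_le_mul_of_nonneg_left (hCd _ hY) (weight_nonneg θ y)

/-! ### The constant: absolute convergence and the tail left out by `N(D, B)` -/

/-- Off the admissible pairs the terms vanish, so sums of `|cTerm|` may be restricted to them.
[folklore] -/
theorem sum_abs_cTerm_eq_filter (𝔠 : (Fin 4 → ℤ) → ℝ) (U : Finset (ℕ × (Fin 4 → ℤ)))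
    [DecidablePred (Adm : ℕ × (Fin 4 → ℤ) → Prop)] :
    ∑ p ∈ U, |cTerm 𝔠 p| = ∑ p ∈ U with Adm p, |cTerm 𝔠 p| := by
  classical
  rw [sum_filter]
  refine sum_congr rfl fun p _ => ?_
  split_ifs with h
  · rfl
  · unfold cTerm; rw [if_neg h, abs_zero]

/-- **Absolute convergence of the constant** (given the shape of Lemma 4.15): the partial sums of
`|cTerm|` are bounded, hence `Σ cTerm` converges absolutely. [cite: Shute2021, §5, (5.10) and
Lemma 5.3] -/
theorem exists_sum_abs_cTerm_le {𝔠 : (Fin 4 → ℤ) → ℝ} (h1 : CoeffBound 𝔠) :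
    ∃ K : ℝ, ∀ U : Finset (ℕ × (Fin 4 → ℤ)), ∑ p ∈ U, |cTerm 𝔠 p| ≤ K := by
  classical
  obtain ⟨C₁, hC₁⟩ := h1 (1 / 100) (by norm_num)
  obtain ⟨Cd, hCd1, hCd⟩ :=
    Literature.NumberTheory.Sieve.exists_card_divisors_le_mul_rpow (ε := 1 / 100) (by norm_num)
  obtain ⟨Cw, hCw, hCwle⟩ := exists_sum_weight_le (θ := 11 * (1 / 100) + 1 / 100) (by norm_num)
  obtain ⟨Z₂, hZ₂, hZ₂le⟩ := exists_sum_rpow_neg_le (s := 2) (by norm_num)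
  refine ⟨max C₁ 0 * Z₂ * (Cd * Cw), fun U => ?_⟩
  rw [sum_abs_cTerm_eq_filter]
  have hU : ∀ p ∈ U.filter Adm, Adm p ∧ True := fun p hp => ⟨(mem_filter.1 hp).2, trivial⟩
  refine (sum_abs_cTerm_le (by norm_num) hC₁ (fun _ => True) (Z := Z₂) (fun T _ => hZ₂le T)
    (U.filter Adm) hU).trans ?_
  refine mul_le_mul_of_nonneg_left ?_ (by positivity)
  have himg : ∀ y ∈ (U.filter Adm).image Prod.snd, ∀ i, y i ≠ 0 := by
    intro y hy
    rw [mem_image] at hy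
    obtain ⟨p, hp, rfl⟩ := hy
    exact fun i => ((mem_filter.1 hp).2.2.1 i).1
  calc ∑ y ∈ (U.filter Adm).image Prod.snd, #((∏ i, y i).natAbs.divisors) * weight (11 * (1 / 100)) y
      ≤ ∑ y ∈ (U.filter Adm).image Prod.snd, Cd * weight (11 * (1 / 100) + 1 / 100) y :=
        sum_le_sum fun y hy => card_divisors_mul_weight_le hCd _ (himg y hy)
    _ = Cd * ∑ y ∈ (U.filter Adm).image Prod.snd, weight (11 * (1 / 100) + 1 / 100) y := by
        rw [mul_sum]
    _ ≤ Cd * Cw := mul_le_mul_of_nonneg_left (hCwle _ himg) (by linarith)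

/-- The series of the constant converges absolutely. [cite: Shute2021, §5, (5.10)] -/
theorem summable_cTerm {𝔠 : (Fin 4 → ℤ) → ℝ} (h1 : CoeffBound 𝔠) : Summable (cTerm 𝔠) := by
  obtain ⟨K, hK⟩ := exists_sum_abs_cTerm_le h1
  exact (summable_of_sum_le (fun p => abs_nonneg _) hK).of_abs

/-- **The part of the constant not produced by `N(D, B)`** (Lemma 5.3 `E₁(D) ≪ D^{-1/4+ε}` plus the
`s₀`-tail of the main terms): if the finite set `W₁` contains every admissible `(d, 𝐲)` with
`|Y| ≤ D` and `d₀(d, 𝐲) ≤ S₀`, then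
`|Σ cTerm − Σ_{W₁} cTerm| ≤ max(C₁,0) C_δ (Z₂ C_t D^{-η} + Z_t S₀^{κ-1} C_w)`, the constants being
those of `CoeffBound` (exponent `ε₁`), the divisor bound (`δ`), `Σ n^{-2}`, the weight tail
(`θ = 11ε₁ + δ`, `η`), the tail `Σ_{n > S} n^{-2} ≤ Z_t S^{κ−1}` and the weight sum.
[cite: Shute2021, Lemma 5.3] -/
theorem const_tail_le {𝔠 : (Fin 4 → ℤ) → ℝ} {ε₁ C₁ : ℝ} (hε₁ : 0 < ε₁)
    (hC₁ : ∀ a : Fin 4 → ℤ, (∀ i, a i ≠ 0) → ¬ IsSquare (∏ i, a i) →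
      |𝔠 a| ≤ C₁ * ((|∏ i, a i| : ℤ) : ℝ) ^ ε₁ * (delta a : ℝ) ^ (1 / 4 : ℝ))
    {δ Cd : ℝ} (hCd : ∀ n : ℕ, n ≠ 0 → (#n.divisors : ℝ) ≤ Cd * (n : ℝ) ^ δ)
    {Cw : ℝ} (hCw : ∀ s : Finset (Fin 4 → ℤ), (∀ y ∈ s, ∀ i, y i ≠ 0) →
      ∑ y ∈ s, weight (11 * ε₁ + δ) y ≤ Cw)
    {η Ct : ℝ} (hCt : ∀ s : Finset (Fin 4 → ℤ), (∀ y ∈ s, ∀ i, y i ≠ 0) → ∀ D : ℝ, 0 < D →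
      ∑ y ∈ s with D < (((∏ i, y i).natAbs : ℕ) : ℝ), weight (11 * ε₁ + δ) y ≤ Ct * D ^ (-η))
    {Z₂ : ℝ} (hZ₂ : ∀ T : Finset ℕ, ∑ n ∈ T, (n : ℝ) ^ (-(2 : ℝ)) ≤ Z₂)
    {κ Zt : ℝ} (hZt : ∀ (T : Finset ℕ) (S : ℝ), 0 < S →
      ∑ n ∈ T with S < ((n : ℕ) : ℝ), ((n : ℕ) : ℝ) ^ (-((1 + κ) + (1 - κ))) ≤ Zt * S ^ (-(1 - κ)))
    (hsum : Summable (cTerm 𝔠)) (D : ℕ) (hD : 1 ≤ D) (S₀ : ℝ) (hS₀ : 0 < S₀)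
    (W₁ : Finset (ℕ × (Fin 4 → ℤ)))
    (hW₁ : ∀ p, Adm p → (∏ i, p.2 i).natAbs ≤ D → (dFree p.1 p.2 : ℝ) ≤ S₀ → p ∈ W₁) :
    |∑' p, cTerm 𝔠 p - ∑ p ∈ W₁, cTerm 𝔠 p| ≤
      max C₁ 0 * Cd * Z₂ * Ct * (D : ℝ) ^ (-η) + max C₁ 0 * Cd * Zt * Cw * S₀ ^ (-(1 - κ)) := by
  classical
  have hCd0 : 0 ≤ Cd := by
    have := hCd 1 one_ne_zero; simp at this; linarith
  have hD0 : (0 : ℝ) < D := by exact_mod_cast hD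
  -- the tail as a sum over the complement of `W₁`
  have hR : ∑' p, cTerm 𝔠 p - ∑ p ∈ W₁, cTerm 𝔠 p =
      ∑' p : ↥((W₁ : Set (ℕ × (Fin 4 → ℤ)))ᶜ), cTerm 𝔠 (p : ℕ × (Fin 4 → ℤ)) := by
    rw [← hsum.sum_add_tsum_compl (s := W₁)]; ring
  rw [hR]
  have habs : Summable fun p : ↥((W₁ : Set (ℕ × (Fin 4 → ℤ)))ᶜ) =>
      ‖cTerm 𝔠 (p : ℕ × (Fin 4 → ℤ))‖ :=
    (hsum.abs.subtype _).congr fun p => (Real.norm_eq_abs _).symm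
  refine (Real.norm_eq_abs _ ▸ norm_tsum_le_tsum_norm habs).trans ?_
  simp only [Real.norm_eq_abs]
  refine Real.tsum_le_of_sum_le (fun p => abs_nonneg _) fun u => ?_
  -- pass to a finite set of pairs outside `W₁`
  set U : Finset (ℕ × (Fin 4 → ℤ)) := u.map (Function.Embedding.subtype _) with hUdef
  have hUout : ∀ p ∈ U, p ∉ W₁ := by
    intro p hp
    rw [hUdef, mem_map] at hp
    obtain ⟨x, -, rfl⟩ := hp
    exact fun h => (Set.mem_compl_iff _ _).1 x.2 (mem_coe.2 h)
  have hsumU : ∑ x ∈ u, |cTerm 𝔠 (x : ℕ × (Fin 4 → ℤ))| = ∑ p ∈ U, |cTerm 𝔠 p| := by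
    rw [hUdef, sum_map]; rfl
  rw [hsumU, sum_abs_cTerm_eq_filter]
  -- split the admissible part by `|Y| ≤ D` or not
  set Ua := (U.filter Adm).filter (fun p => D < (∏ i, p.2 i).natAbs) with hUa
  set Ub := (U.filter Adm).filter (fun p => ¬ D < (∏ i, p.2 i).natAbs) with hUb
  rw [← sum_filter_add_sum_filter_not (U.filter Adm) (fun p => D < (∏ i, p.2 i).natAbs)]
  -- the two engines
  have ha : ∑ p ∈ Ua, |cTerm 𝔠 p| ≤ max C₁ 0 * Z₂ * (Cd * (Ct * (D : ℝ) ^ (-η))) := by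
    have hU : ∀ p ∈ Ua, Adm p ∧ True := fun p hp =>
      ⟨(mem_filter.1 (mem_filter.1 hp).1).2, trivial⟩
    refine (sum_abs_cTerm_le hε₁ hC₁ (fun _ => True) (Z := Z₂) (fun T _ => hZ₂ T) Ua hU).trans ?_
    refine mul_le_mul_of_nonneg_left ?_ (by
      have := hZ₂ ∅; simp at this; positivity)
    have himg : ∀ y ∈ Ua.image Prod.snd, (∀ i, y i ≠ 0) ∧ D < (∏ i, y i).natAbs := by
      intro y hy
      rw [mem_image] at hy
      obtain ⟨p, hp, rfl⟩ := hy
      rw [hUa, mem_filter, mem_filter] at hp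
      exact ⟨fun i => (hp.1.2.2.1 i).1, hp.2⟩
    calc ∑ y ∈ Ua.image Prod.snd, #((∏ i, y i).natAbs.divisors) * weight (11 * ε₁) y
        ≤ ∑ y ∈ Ua.image Prod.snd, Cd * weight (11 * ε₁ + δ) y :=
          sum_le_sum fun y hy => card_divisors_mul_weight_le hCd _ (himg y hy).1
      _ = Cd * ∑ y ∈ Ua.image Prod.snd with (D : ℝ) < (((∏ i, y i).natAbs : ℕ) : ℝ),
            weight (11 * ε₁ + δ) y := by
          rw [mul_sum, filter_true_of_mem]
          intro y hy; exact_mod_cast (himg y hy).2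
      _ ≤ Cd * (Ct * (D : ℝ) ^ (-η)) :=
          mul_le_mul_of_nonneg_left (hCt _ (fun y hy => (himg y hy).1) D hD0) hCd0
  have hb : ∑ p ∈ Ub, |cTerm 𝔠 p| ≤ max C₁ 0 * (Zt * S₀ ^ (-(1 - κ))) * (Cd * Cw) := by
    have hU : ∀ p ∈ Ub, Adm p ∧ S₀ < (dFree p.1 p.2 : ℝ) := by
      intro p hp
      rw [hUb, mem_filter, mem_filter] at hp
      obtain ⟨⟨hpU, hadm⟩, hle⟩ := hp
      refine ⟨hadm, lt_of_not_ge fun hS => hUout p hpU ?_⟩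
      exact hW₁ p hadm (le_of_not_gt hle) hS
    have hZ' : ∀ T : Finset ℕ, (∀ n ∈ T, S₀ < (n : ℝ)) →
        ∑ n ∈ T, (n : ℝ) ^ (-(2 : ℝ)) ≤ Zt * S₀ ^ (-(1 - κ)) := by
      intro T hT
      have h := hZt T S₀ hS₀
      rw [filter_true_of_mem hT] at h
      refine le_trans (le_of_eq (sum_congr rfl fun n _ => ?_)) h
      ring_nf
    refine (sum_abs_cTerm_le hε₁ hC₁ (fun n => S₀ < (n : ℝ)) hZ' Ub hU).trans ?_
    refine mul_le_mul_of_nonneg_left ?_ (by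
      have := hZ' ∅ (by simp)
      rw [sum_empty] at this
      exact mul_nonneg (le_max_right _ _) this)
    have himg : ∀ y ∈ Ub.image Prod.snd, ∀ i, y i ≠ 0 := by
      intro y hy
      rw [mem_image] at hy
      obtain ⟨p, hp, rfl⟩ := hy
      rw [hUb, mem_filter, mem_filter] at hp
      exact fun i => (hp.1.2.2.1 i).1
    calc ∑ y ∈ Ub.image Prod.snd, #((∏ i, y i).natAbs.divisors) * weight (11 * ε₁) y
        ≤ ∑ y ∈ Ub.image Prod.snd, Cd * weight (11 * ε₁ + δ) y :=
          sum_le_sum fun y hy => card_divisors_mul_weight_le hCd _ (himg y hy)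
      _ = Cd * ∑ y ∈ Ub.image Prod.snd, weight (11 * ε₁ + δ) y := by rw [mul_sum]
      _ ≤ Cd * Cw := mul_le_mul_of_nonneg_left (hCw _ himg) hCd0
  calc ∑ p ∈ Ua, |cTerm 𝔠 p| + ∑ p ∈ Ub, |cTerm 𝔠 p|
      ≤ max C₁ 0 * Z₂ * (Cd * (Ct * (D : ℝ) ^ (-η))) +
          max C₁ 0 * (Zt * S₀ ^ (-(1 - κ))) * (Cd * Cw) := add_le_add ha hb
    _ = max C₁ 0 * Cd * Z₂ * Ct * (D : ℝ) ^ (-η) + max C₁ 0 * Cd * Zt * Cw * S₀ ^ (-(1 - κ)) := by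
        ring

end Shute2021

end Literature.NumberTheory.DiophantineGeometry
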